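import Mathlib
import HarnessLib
import Summits.NavierStokesRegularity.NavierStokesRegularity.Theorems.QuarterLogPincerSilencingCostDefs
import Literature.Analysis.FluidPDE.Vorticity
import Literature.Analysis.FluidPDE.BallCutoff

/-!
# Route `QuarterLogPincer`, crux `TypeIQuantSubcubicExp` (stmt-NavierStokesRegularity-24077), line `vortical_centre` —
# the line's OBJECTS, verbatim (Defs file): the localised vorticity, H1, H2, H2♭

VERBATIM port of the statement objects of ns-idea-7 g13's workfile `Cruxes/TypeIQuantSubcubicExp/Lines/vortical_centre.lean`
(v1 PASS idea-crit-4 2026-08-29T09:42Z, v1.1 re-stamp PASS 09:43:55Z «H1 PROVED»; objects H1/H2 IDENTICAL v1 → v1.2; H2♭ added in v1.2,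
tree content sha16 51dbd9e0ddc6fe01): §0 `cutVorticity` (+ `cutVorticity_apply`), §1 H1 `HelmholtzNearField` (near/far Biot–Savart bound of
the cut-off vorticity at the centre), H2 `HarmonicRemainder` (the harmonic remainder of the local Helmholtz decomposition at the centre),
H2♭ `ShellKernelBound` (the remainder bounded by `R⁻³∫_{B_R}‖v‖ + R⁻²∫_{B_R}‖curl v‖` — interior mean value + Fubini; H2 ⟸ H2♭ is proved in
`…HelmholtzCentreKernel`); namespace `…Cruxes.TypeIQuantSubcubicExp.HelmholtzCentre`.  All three are LINEAR potential theory (no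
Navier–Stokes).  Only textual change: docstring added to `cutVorticity_apply`.  No stub is proved here.  HONEST FRAME: Props about
`C²` vector fields; Sb `SilencingCost.VorticalCentre` ⟸ H1 + H2 is the line's kernel; nothing here bears on 24077's truth, W7 or
Navier–Stokes regularity (OPEN / not proved).  pub-ns-dss typer (g38), `--supports stmt-NavierStokesRegularity-24077`; text by ns-idea-7 (g13).
-/

set_option linter.dupNamespace false

noncomputable section

open MeasureTheory Set Function Filter Topology Metric
open scoped ENNReal NNReal
open Literature.Analysis Literature.Analysis.FluidPDE

namespace Summit.NavierStokesRegularity.NavierStokesRegularity.Cruxes.TypeIQuantSubcubicExp.HelmholtzCentre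

/-- The vorticity of `v` cut off to the ball `B(y,R)`: `χ·curl v` with `χ = ballCutoff y (R/3)` (tree
`BallCutoff.lean`: `χ = 1` on `B̄(y, 2R/3)`, `χ = 0` off `B(y, R)`, `0 ≤ χ ≤ 1`, `χ ∈ C^∞`). -/
def cutVorticity (v : (EuclideanSpace ℝ (Fin 3)) → (EuclideanSpace ℝ (Fin 3))) (y : EuclideanSpace ℝ (Fin 3))
    (R : ℝ) : (EuclideanSpace ℝ (Fin 3)) → (EuclideanSpace ℝ (Fin 3)) :=
  fun x => ballCutoff y (R / 3) x • curl v x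

/-- Unfolding lemma for `cutVorticity`. -/
theorem cutVorticity_apply (v : (EuclideanSpace ℝ (Fin 3)) → (EuclideanSpace ℝ (Fin 3)))
    (y x : EuclideanSpace ℝ (Fin 3)) (R : ℝ) :
    cutVorticity v y R x = ballCutoff y (R / 3) x • curl v x := rfl

/-- **H1 — `HelmholtzNearField` (size S–M; PROVED below in v1.1, `helmholtzNearField_holds`).**  Near/far bound for the Biot–Savart integral of the
cut-off vorticity AT THE CENTRE: for `v ∈ C²(ℝ³;ℝ³)`, `0 < ρ`, `3ρ ≤ R`, a first-derivative bound
`‖Dv‖ ≤ L` on `B(y,ρ)` and enstrophy `∫_{B(y,R)}‖curl v‖² ≤ W`,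
`‖K∗(χ_{y,R} curl v)(y)‖ ≤ C(ρL + √(R³W)/ρ²)`.
Proof sketch: `|K(z)| ≤ (4π|z|²)⁻¹` (tree `norm_biotSavartKernel_le`); near part
`∫_{B(y,ρ)} ‖curl v‖/(4π|x−y|²) ≤ ρ·sup_{B(y,ρ)}‖curl v‖ ≤ ρ‖curlCLM‖L` (`norm_curl_le`, `‖iteratedFDeriv ℝ 1 v x‖ = ‖Dv(x)‖`,
tree `integral_kernelMajorant`: `∫_{|z|<ρ}|z|⁻² = 4πρ`); far part CRUDELY: `|K| ≤ (4πρ²)⁻¹` off `B(y,ρ)` and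
Cauchy–Schwarz on `B(y,R)`, `∫_{B(y,R)}‖χ curl v‖ ≤ |B_R|^{1/2}√W = (4π/3)^{1/2}R^{3/2}√W` (Mathlib
`Measure.addHaar_ball`: `|B_R| = R³|B_1|`) — the sharper `√(W/ρ)` (Cauchy–Schwarz against `|z|⁻⁴`) is not
needed by the kernel, which chooses `δ` last.  Why it might fail: not as mathematics.
Sources: Majda–Bertozzi 2002 §2.4.1 Prop. 2.16, §4.1.3 Lemma 4.5 (tree `norm_biotSavart_le_of_support_subset`,
`BiotSavartBounds.lean`). -/
def HelmholtzNearField : Prop :=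
  ∃ C : ℝ, 1 ≤ C ∧
    ∀ (v : (EuclideanSpace ℝ (Fin 3)) → (EuclideanSpace ℝ (Fin 3))), ContDiff ℝ 2 v →
      ∀ (y : EuclideanSpace ℝ (Fin 3)) (ρ R L W : ℝ), 0 < ρ → 3 * ρ ≤ R →
        (∀ x ∈ ball y ρ, ‖iteratedFDeriv ℝ 1 v x‖ ≤ L) →
        (∫⁻ x in ball y R, ‖curl v x‖ₑ ^ 2 ≤ ENNReal.ofReal W) → 0 ≤ W →
        ‖biotSavart (cutVorticity v y R) y‖ ≤ C * (ρ * L + Real.sqrt (R ^ 3 * W) / ρ ^ 2)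

/-- **H2 — `HarmonicRemainder` (size M; port — THE NEAR-MISS REPAIR).**  For `v ∈ C²(ℝ³;ℝ³)` divergence
free, the Helmholtz remainder `H := v − K∗(χ_{y,R} curl v)` is harmonic on `B(y, 2R/3)` (tree
`smul_eq_biotSavart_add_integral_newtonKernel` + `laplacian_smul_add_curl_smul_curl_eq`: the Newtonian density
`G = Δ(χv) + curl(χ curl v)` vanishes where `χ ≡ 1`), hence by the MEAN-VALUE property and Young's inequality
for `K·1_{B(0,4R/3)} ∈ L¹` (`‖K∗(χω)‖_{L²(B(y,R/3))} ≤ (4R/3)‖χω‖_{L²}`):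
`‖v(y) − K∗(χ_{y,R} curl v)(y)‖ ≤ C(√(E/R³) + √(W/R))` from slice energy `∫_{B(y,R)}|v|² ≤ E` and
enstrophy `∫_{B(y,R)}‖curl v‖² ≤ W` ONLY — no `∫‖Dv‖` on the shell (the deficit of the tree's
`exists_norm_sub_biotSavart_ballCutoff_le`), constants scale-free.  Why it might fail: not as mathematics;
porting cost = mean-value inequality for harmonic functions on balls of `ℝ³` (absent from Mathlib).
Sources: Gilbarg–Trudinger Thm 2.1 + (2.17); Grujić 2009 §3 (3)–(4) (tree `LocalBiotSavartHelmholtz.lean`). -/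
def HarmonicRemainder : Prop :=
  ∃ C : ℝ, 1 ≤ C ∧
    ∀ (v : (EuclideanSpace ℝ (Fin 3)) → (EuclideanSpace ℝ (Fin 3))), ContDiff ℝ 2 v →
      VectorCalculus.IsDivFree v →
      ∀ (y : EuclideanSpace ℝ (Fin 3)) (R E W : ℝ), 0 < R →
        (∫⁻ x in ball y R, ENNReal.ofReal (‖v x‖ ^ 2) ≤ ENNReal.ofReal E) → 0 ≤ E →
        (∫⁻ x in ball y R, ‖curl v x‖ₑ ^ 2 ≤ ENNReal.ofReal W) → 0 ≤ W →
        ‖v y - biotSavart (cutVorticity v y R) y‖ ≤ C * (Real.sqrt (E / R ^ 3) + Real.sqrt (W / R))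

/-- **H2♭ — `ShellKernelBound` (size S–M; v1.2 — the brick-free route to H2).**  For `v ∈ C²(ℝ³;ℝ³)`
divergence free and `R > 0`, AT THE CENTRE of the cutoff `χ = ballCutoff y (R/3)` (`χ ≡ 1` on `B̄(y,2R/3)`):
`‖v(y) − K∗(χ curl v)(y)‖ ≤ C(R⁻³∫_{B(y,R)}‖v‖ + R⁻²∫_{B(y,R)}‖curl v‖)`.
Proof route (no mean-value property, no harmonic-function theory): the tree's Green representation
`smul_eq_biotSavart_add_integral_newtonKernel` gives `v(y) − K∗(χω)(y) = ∫Γ(y−z)G(z)dz` with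
`G = (Δχ)v + 2Σᵢ∂ᵢχ∂ᵢv + ∇χ×ω` (`laplacian_smul_add_curl_smul_curl_eq`, `div v = 0`), supported in the shell
`2R/3 ≤ |z−y| ≤ R` where `Γ(y−·)` is smooth; ONE integration by parts moves `∂ᵢ` off `v` in the middle term:
`∫Γ∂ᵢχ∂ᵢv = ∫[(∂ᵢΓ)(y−z)∂ᵢχ − ΓΔχ]v`; then `|Γ| ≤ 3/(8πR)`, `|∇Γ| ≤ 9/(16πR²)` on the shell and
`|∇χ| ≤ c/R`, `|Δχ| ≤ c/R²` (tree `BallCutoff`/`radialCutoff` derivative bounds) give the integrand bound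
`C(R⁻³‖v‖ + R⁻²‖curl v‖)·1_{B(y,R)}`.  This REMOVES the `∫‖Dv‖`-deficit of `exists_norm_sub_biotSavart_ballCutoff_le`
by IBP instead of by the mean-value inequality (critic N2's Mathlib-gap brick is thereby OFF the E-chain's path).
Why it might fail: not as mathematics; porting cost = IBP of a `C¹` compactly supported product on `ℝ³`
(Mathlib `integral_mul_deriv_eq_deriv_mul`-type lemmas coordinatewise, or the divergence theorem for compactly
supported fields already used in `Literature/Analysis/FluidPDE`).  Sources: Gilbarg–Trudinger §2.4 (2.16)–(2.17);
Grujić 2009 §3 (3)–(4); Majda–Bertozzi §2.4.1. -/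
def ShellKernelBound : Prop :=
  ∃ C : ℝ, 1 ≤ C ∧
    ∀ (v : (EuclideanSpace ℝ (Fin 3)) → (EuclideanSpace ℝ (Fin 3))), ContDiff ℝ 2 v →
      VectorCalculus.IsDivFree v →
      ∀ (y : EuclideanSpace ℝ (Fin 3)) (R : ℝ), 0 < R →
        ‖v y - biotSavart (cutVorticity v y R) y‖ ≤
          C * ((R ^ 3)⁻¹ * (∫ x in ball y R, ‖v x‖) + (R ^ 2)⁻¹ * (∫ x in ball y R, ‖curl v x‖))

end Summit.NavierStokesRegularity.NavierStokesRegularity.Cruxes.TypeIQuantSubcubicExp.HelmholtzCentre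

end
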